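import Summits.AtomisticToContinuum.HydrodynamicLimit.Theorems.LambertianContactSwapSwapGapStubFieldConcentrationStatic
import Summits.AtomisticToContinuum.HydrodynamicLimit.Theorems.LambertianContactSwapSwapGapEntropyTools
import HarnessLib

/-!
# `SwapGap` (stmt-AtomisticToContinuum-11850), line `Sketch`, stub `stub_detFieldConcentration_zero` (T21):
# the `t = 0` instance of the deterministic field concentration S2ʳ

Rung T21 of v12 §12 (the reversed entropy line) of line `Sketch` for the crux
`Summit.AtomisticToContinuum.HydrodynamicLimit.Theses.LambertianContactSwap.SwapGap`.
The research stub S2ʳ (`stub_detFieldConcentration`) asks for speed-`N` concentration of every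
`1`-Lipschitz statistic `F` bounded by `1` of the `χ`-tested empirical field triple
`(density, momentum, energy)` of the DETERMINISTIC hard-sphere flow `Φ_t z` under the local Gibbs law
`P_N = localGibbsLaw σ a₀ u₀ θ₀ N Φ`, about its own `P_N`-mean. Here: its `t = 0` instance, for all
continuous profiles `a₀, θ₀ > 0`, `u₀`, all `0 < σ < σ₀` (the `σ₀` of R0), every flow, `χ`, `F`, `δ`.

Mechanism: `Φ_0 = id` on the good set (`HardSphereFlow.flow_zero`), which carries `P_N`
(`measure_compl_good_eq_zero_of_absolutelyContinuous`, as `P_N ≪ Liouville` — `localGibbsLaw` is a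
`withDensity` of the Liouville measure), so `P_N`-a.e. `F(fld(Φ_0 z)) = F(fld z)`: the mean
(`integral_congr_ae`) and the deviation event (`measure_congr`) are the STATIC ones, and the landed
static concentration R0 (`stub_fieldConcentration_static`, uniform in `N` and in the flow) gives the
bound with the same constant.

prover-line-stmt-AtomisticToContinuum-11850-c6-0, cycle 7 (stub worker T21).
-/

noncomputable section

open MeasureTheory Filter Set Topology InformationTheory
open scoped ENNReal

namespace Summit.AtomisticToContinuum.HydrodynamicLimit.Theorems

open Literature.Analysis.FluidPDE Literature.MathematicalPhysics.KineticTheory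

/-- **T21 · THE `t = 0` INSTANCE OF S2ʳ.** For continuous profiles `a₀, θ₀ > 0`, `u₀` there is
`σ₀ > 0` (the one of R0, `stub_fieldConcentration_static`) such that for `0 < σ < σ₀`, all flows `Φ`,
every continuous `χ`, every `1`-Lipschitz `F` bounded by `1` and every `δ > 0` there is `C > 0` with
`P_N{δ < |F(fld(Φ_0 z)) − ∫ F(fld(Φ_0 w)) dP_N|} ≤ C e^{−(N+1)/C}` for all `N`, where
`P_N = localGibbsLaw σ a₀ u₀ θ₀ N (Φ N)`: `Φ_0 = id` on the good set (`HardSphereFlow.flow_zero`),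
which carries `P_N` (`measure_compl_good_eq_zero_of_absolutelyContinuous`, `P_N ≪ Liouville`), so the
event and the mean are the static ones of R0 up to a `P_N`-null set (`measure_congr`,
`integral_congr_ae`). [folklore] -/
theorem stub_detFieldConcentration_zero :
    ∀ (a₀ θ₀ : T3 → ℝ) (u₀ : T3 → V3), Continuous a₀ → Continuous θ₀ → Continuous u₀ →
      (∀ x, 0 < a₀ x) → (∀ x, 0 < θ₀ x) →
      ∃ σ₀ : ℝ, 0 < σ₀ ∧ ∀ σ : ℝ, 0 < σ → σ < σ₀ →
        ∀ Φ : (N : ℕ) → HardSphereFlow (Torus.geometry (Fin 3)) (hsDiameter σ N) (N + 1),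
          ∀ χ : T3 → ℝ, Continuous χ → ∀ F : ℝ × V3 × ℝ → ℝ, LipschitzWith 1 F → (∀ y, |F y| ≤ 1) →
            ∀ δ : ℝ, 0 < δ → ∃ C : ℝ, 0 < C ∧ ∀ N : ℕ,
              (localGibbsLaw σ a₀ u₀ θ₀ N (Φ N))
                {z | δ < |F (empiricalDensityField ((Φ N).flow 0 z) χ,
                      empiricalMomentumField ((Φ N).flow 0 z) χ,
                      empiricalEnergyField ((Φ N).flow 0 z) χ) -
                    ∫ w, F (empiricalDensityField ((Φ N).flow 0 w) χ,
                      empiricalMomentumField ((Φ N).flow 0 w) χ,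
                      empiricalEnergyField ((Φ N).flow 0 w) χ)
                      ∂(localGibbsLaw σ a₀ u₀ θ₀ N (Φ N))|} ≤
                ENNReal.ofReal (C * Real.exp (-(C⁻¹ * ((N : ℝ) + 1)))) := by
  intro a₀ θ₀ u₀ ha hθ hu ha0 hθ0
  obtain ⟨σ₁, hσ₁, hstat⟩ := stub_fieldConcentration_static a₀ θ₀ u₀ ha hθ hu ha0 hθ0
  refine ⟨σ₁, hσ₁, ?_⟩
  intro σ hσ hσlt Φ χ hχ F hF hF1 δ hδ
  obtain ⟨C, hC, hCN⟩ := hstat σ hσ hσlt χ hχ F hF hF1 δ hδ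
  refine ⟨C, hC, fun N => ?_⟩
  set P : Measure (Config (N + 1) (Fin 3) T3) := localGibbsLaw σ a₀ u₀ θ₀ N (Φ N) with hPdef
  set G : Config (N + 1) (Fin 3) T3 → ℝ := fun z =>
    F (empiricalDensityField z χ, empiricalMomentumField z χ, empiricalEnergyField z χ)
  -- the local Gibbs law is absolutely continuous w.r.t. Liouville, hence carried by the good set
  have hPac : P ≪ liouville (Torus.geometry (Fin 3)) (N + 1) (hsDiameter σ N) := by
    rw [hPdef, localGibbsLaw, particleLaw_eq]
    exact withDensity_absolutelyContinuous _ _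
  have hgood : ∀ᵐ z ∂P, z ∈ (Φ N).good := by
    rw [ae_iff]
    exact measure_compl_good_eq_zero_of_absolutelyContinuous (Φ N) hPac
  -- `Φ_0 = id` almost surely
  have hflow : ∀ᵐ z ∂P, (Φ N).flow 0 z = z := hgood.mono fun z hz => (Φ N).flow_zero z hz
  -- the mean and the event are the static ones
  have hmean : ∫ w, G ((Φ N).flow 0 w) ∂P = ∫ w, G w ∂P :=
    integral_congr_ae (hflow.mono fun z hz => by
      show G ((Φ N).flow 0 z) = G z
      rw [hz])
  have hev : P {z | δ < |G ((Φ N).flow 0 z) - ∫ w, G w ∂P|} = P {z | δ < |G z - ∫ w, G w ∂P|} :=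
    measure_congr (Filter.eventuallyEq_set.2 (hflow.mono fun z hz => by
      rw [mem_setOf_eq, mem_setOf_eq, hz]))
  show P {z | δ < |G ((Φ N).flow 0 z) - ∫ w, G ((Φ N).flow 0 w) ∂P|} ≤
    ENNReal.ofReal (C * Real.exp (-(C⁻¹ * ((N : ℝ) + 1))))
  rw [hmean, hev]
  exact hCN N (Φ N)

end Summit.AtomisticToContinuum.HydrodynamicLimit.Theorems

end
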